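import Summits.Ventures.YMGap.SlabAreaLawVariance
import Summits.Ventures.YMGap.Thresholds.QuarterModulusTwoThirds
import Literature.MathematicalPhysics.QuantumFieldTheory.DurhuusFrohlichSlabCriterionProofs
import HarnessLib

/-!
# Venture YMGap, track (a) / A4, part 7 — the slab door's reach as a function of the dimension `d`:
# `SU(2)` Wilson AREA LAW for `β_W < 2/(d−1)` in every `d ≥ 2` (unconditional), `SU(3)` for `β_W ≤ 33/(20(d−1))`
# conditional on ONE certified finite-dimensional inequality

HONEST FRAMING: venture file of the cell `pub-ymgap` (QuantumFields programme), seat ENGINE 2 (generation g2).  Kernel ARITHMETIC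
over tree theorems; no new estimate.  The slab door `Slab.hasAreaLaw_of_oneLinkKRModulus` (p1) is stated for every `d ≥ 2`: a one-link
Kantorovich–Rubinstein modulus `OneLinkKRModulus N R K` on the ball `R ≥ 2(d−1)β` ('t Hooft `β`) with `2(d−1)βK < 1` gives the area law
modulo the Durhuus–Fröhlich/Cao–Nissim–Sheffield slab criterion — and that criterion is now a TREE THEOREM for all `d`, `N` (lit-1's
`durhuusFrohlich_areaLaw_of_slabClustering_holds`, CNS25 §2 as printed).  The cell booked the `d = 4` rows (`SU(2)`: `β_W < 2/3`,
`QuarterModulusTwoThirds`; `SU(3)`: `β_W ≤ 11/20` given the variance bound, `SlabAreaLawVariance`).  This file only records how the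
SAME two one-link inputs scale with `d` — the dimension enters the door solely through the slab radius `2(d−1)β`:
* `su2_oneLinkKRModulus_one_one`: the in-tree quarter modulus at its end-point, `OneLinkKRModulus 2 1 1` (engine-2 g0's ball-flux
  certificate chain, `QuarterModulusTwoThirds.oneLinkKRModulusSU2_of_le_twoThirds` at `β_W = 2/3`, unfolded), hence on every ball `R ≤ 1`;
* `su2_hasAreaLaw_of_lt_two` (UNCONDITIONAL, all `d ≥ 2`): Wilson units `β_W = 4β`, tree coupling `β_W/2`, slab radius `(d−1)β_W/2`:
  `0 ≤ β_W`, `(d−1)·β_W < 2` ⟹ `HasAreaLaw d (fundamentalRep (Fin 2)) (β_W/2)` — i.e. `SU(2)` AREA LAW for every `β_W < 2/(d−1)`: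
  `d = 3`: `β_W < 1`; `d = 4`: `β_W < 2/3` (the booked row, `Slab`/`QuarterModulusTwoThirds`); `d = 5`: `β_W < 1/2`.  Printed comparison
  (CNS25 Thm. 1.6, 't Hooft `β < 1/(8(d−1))`, i.e. `β_W < 1/(2(d−1))`): `× 4` in every dimension (`su2_hasAreaLaw_thooft` states it in
  't Hooft units next to `Slab.hasAreaLaw_of_lt_cnsThreshold`); instances `su2_hasAreaLaw_d3_lt_one`, `su2_hasAreaLaw_d5_lt_half` (the `d = 4` hypothesis-free rows are p1's
  `SlabAreaLawUnconditional`, not restated here);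
* `su3_hasAreaLaw_of_varianceBound_dim` (CONDITIONAL on ONE displayed finite-dimensional hypothesis, all `d ≥ 2`): IF
  `OneLinkVarianceBound 3 (11/30) (49/20)` (certified at grade C-iv outside the kernel by two independent ball-arithmetic engines of the
  pub-balaban cell, replayed under this cell's tag; NOT a tree theorem) THEN `0 ≤ β_W`, `(d−1)·β_W ≤ 33/20` ⟹
  `HasAreaLaw d (fundamentalRep (Fin 3)) (β_W/3)` — `SU(3)` area law for `β_W ≤ 33/(20(d−1))` (`d = 3`: `33/40`; `d = 4`: `11/20`, the booked
  row, restated DF-free in p1's `SlabAreaLawUnconditional`; `d = 5`: `33/80`), Bakry–Émery supplying the Poincaré side (`1/(3(1/2 − 11/30)) = 5/2`);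
  printed: `β_W < 9/(8(d−1))`; instance `su3_hasAreaLaw_d3_le_of_varianceBound`;
* `slabDimensions_numbers`: the arithmetic.
CLASS: K (the `SU(2)` rows, no hypothesis at all) ∕ K-conditional on one displayed certified-outside-the-kernel inequality (the `SU(3)` rows).
Strong-coupling LATTICE statements only (in `d = 3` as much as in `d = 4`); no continuum limit, no mass-gap or Clay claim; nothing here
changes a `d = 4` number of the cell.
-/

noncomputable section

open MeasureTheory ProbabilityTheory
open Literature.MathematicalPhysics.QuantumLattice
open Literature.MathematicalPhysics.QuantumFieldTheory
open Literature.MathematicalPhysics.QuantumFieldTheory.Balaban1983to89.StrongCouplingDobrushinWindow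
open Summit.QuantumFields.BalabanUV.InfraRed.StrongCouplingVarianceDoorSUN (OneLinkVarianceBound)
open Summit.Ventures.YMGap.Slab (hasAreaLaw_of_oneLinkKRModulus)
open Summit.Ventures.YMGap.SlabAreaLawVariance (hasAreaLaw_of_varianceBound')
open Summit.Ventures.YMGap.QuarterModulusTwoThirds (oneLinkKRModulusSU2_of_le_twoThirds)

namespace Summit.Ventures.YMGap.SlabAreaLawDimensions

/-! ## 1. `SU(2)`: the quarter modulus on the unit ball and the area law for `β_W < 2/(d−1)` in every dimension -/

/-- **The in-tree `SU(2)` quarter modulus at its end-point**: `OneLinkKRModulus 2 1 1` — the one-link tilted laws `ν_B`, `‖B‖_op ≤ 1`,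
are `1`-Lipschitz from the Frobenius norm to the Kantorovich–Rubinstein distance (`OneLinkKRModulusSU2 (2/3) (1/4)` unfolded:
`3·(2/3)/2 = 1`, `4·(1/4) = 1`; engine-2 g0's ball-flux certificate chain). [folklore] -/
theorem su2_oneLinkKRModulus_one_one : OneLinkKRModulus 2 1 1 := by
  have h := oneLinkKRModulusSU2_of_le_twoThirds (βW := 2 / 3) le_rfl
  unfold OneLinkKRModulusSU2 at h
  norm_num at h
  exact h

/-- The quarter modulus on every ball of radius `R ≤ 1`. [folklore] -/
theorem su2_oneLinkKRModulus_of_le_one {R : ℝ} (hR : R ≤ 1) : OneLinkKRModulus 2 R 1 :=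
  su2_oneLinkKRModulus_one_one.mono_radius hR

/-- **`SU(2)` Wilson AREA LAW in every dimension `d ≥ 2` for `0 ≤ β_W < 2/(d−1)` — UNCONDITIONAL.**  Wilson units `β_W = 4β`
('t Hooft `β`), tree coupling `2β = β_W/2`; the slab radius is `2(d−1)β = (d−1)β_W/2 < 1`, so the unit-ball quarter modulus applies and the
slab Dobrushin constant is `(d−1)β_W/2 · 1 < 1`; the Durhuus–Fröhlich/CNS criterion is the tree theorem
`durhuusFrohlich_areaLaw_of_slabClustering_holds`.  `d = 4` gives back the cell's booked `β_W < 2/3`; printed CNS25 Thm. 1.6 is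
`β_W < 1/(2(d−1))`. [cite: CaoNissimSheffield2025dynamical, Theorems 1.6 and 2.3] -/
theorem su2_hasAreaLaw_of_lt_two {d : ℕ} (hd : 2 ≤ d) {βW : ℝ} (hβ : 0 ≤ βW) (hlt : ((d : ℝ) - 1) * βW < 2) :
    HasAreaLaw d (fundamentalRep (Fin 2)) (βW / 2) := by
  have hd1 : (0 : ℝ) ≤ (d : ℝ) - 1 := by
    have : (2 : ℝ) ≤ d := by exact_mod_cast hd
    linarith
  have h2 : ((2 : ℕ) : ℝ) * (βW / 4) = βW / 2 := by push_cast; ring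
  rw [← h2]
  refine hasAreaLaw_of_oneLinkKRModulus (durhuusFrohlich_areaLaw_of_slabClustering_holds (d := d) (N := 2)) hd le_rfl
    (β := βW / 4) (R := 1) (K := 1) (by positivity) zero_le_one ?_ su2_oneLinkKRModulus_one_one ?_
  · -- radius: (βW/4)·(2(d−1)) = (d−1)βW/2 ≤ 1
    nlinarith
  · -- door: 2(d−1)·(βW/4)·1 = (d−1)βW/2 < 1
    nlinarith

/-- The same with the threshold written as `β_W < 2/(d−1)` (`d ≥ 2`). [cite: CaoNissimSheffield2025dynamical, Theorems 1.6 and 2.3] -/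
theorem su2_hasAreaLaw_of_lt_two_div {d : ℕ} (hd : 2 ≤ d) {βW : ℝ} (hβ : 0 ≤ βW) (hlt : βW < 2 / ((d : ℝ) - 1)) :
    HasAreaLaw d (fundamentalRep (Fin 2)) (βW / 2) := by
  have hd1 : (0 : ℝ) < (d : ℝ) - 1 := by
    have : (2 : ℝ) ≤ d := by exact_mod_cast hd
    linarith
  refine su2_hasAreaLaw_of_lt_two hd hβ ?_
  have := (lt_div_iff₀ hd1).1 hlt
  linarith

/-- **'t Hooft units, side by side with the printed threshold**: for `SU(2)` the slab door with the quarter modulus gives the area law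
`HasAreaLaw d (fundamentalRep (Fin 2)) (2β)` for every 't Hooft `0 ≤ β < 1/(2(d−1))` — FOUR times the printed Cao–Nissim–Sheffield threshold
`β < 1/(8(d−1))` of `Slab.hasAreaLaw_of_lt_cnsThreshold` (same statement shape, `N = 2`), unconditional. [cite: CaoNissimSheffield2025dynamical, Theorems 1.6 and 2.3] -/
theorem su2_hasAreaLaw_thooft {d : ℕ} (hd : 2 ≤ d) {β : ℝ} (hβ : 0 ≤ β) (hlt : β < 1 / (2 * ((d : ℝ) - 1))) :
    HasAreaLaw d (fundamentalRep (Fin 2)) (((2 : ℕ) : ℝ) * β) := by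
  have hd1 : (0 : ℝ) < (d : ℝ) - 1 := by
    have : (2 : ℝ) ≤ d := by exact_mod_cast hd
    linarith
  have e : (((2 : ℕ) : ℝ)) * β = (4 * β) / 2 := by push_cast; ring
  rw [e]
  refine su2_hasAreaLaw_of_lt_two hd (by positivity) ?_
  have h2 : 0 < 2 * ((d : ℝ) - 1) := by positivity
  have := (lt_div_iff₀ h2).1 hlt
  nlinarith

/-- **`SU(2)`, `d = 3`: Wilson AREA LAW for every `0 ≤ β_W < 1` — UNCONDITIONAL** (printed CNS: `β_W < 1/4`).
[cite: CaoNissimSheffield2025dynamical, Theorems 1.6 and 2.3] -/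
theorem su2_hasAreaLaw_d3_lt_one {βW : ℝ} (hβ : 0 ≤ βW) (hlt : βW < 1) :
    HasAreaLaw 3 (fundamentalRep (Fin 2)) (βW / 2) :=
  su2_hasAreaLaw_of_lt_two (by norm_num) hβ (by push_cast; linarith)

/-- **`SU(2)`, `d = 5`: Wilson AREA LAW for every `0 ≤ β_W < 1/2` — UNCONDITIONAL** (printed CNS: `β_W < 1/8`).
[cite: CaoNissimSheffield2025dynamical, Theorems 1.6 and 2.3] -/
theorem su2_hasAreaLaw_d5_lt_half {βW : ℝ} (hβ : 0 ≤ βW) (hlt : βW < 1 / 2) :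
    HasAreaLaw 5 (fundamentalRep (Fin 2)) (βW / 2) :=
  su2_hasAreaLaw_of_lt_two (by norm_num) hβ (by push_cast; linarith)

/-! ## 2. `SU(3)`: the variance door in every dimension -/

/-- **`SU(3)` Wilson AREA LAW in every dimension `d ≥ 2` for `0 ≤ β_W ≤ 33/(20(d−1))` — CONDITIONAL on ONE finite-dimensional
inequality.**  IF `OneLinkVarianceBound 3 (11/30) (49/20)` (DISPLAYED; certified at grade C-iv outside the kernel, NOT a tree theorem)
THEN — 't Hooft `β = β_W/9`, tree coupling `β_W/3`, slab radius `2(d−1)β_W/9 ≤ 11/30`, Bakry–Émery Poincaré constant `5/2`, door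
`(2(d−1)β_W/9)²·(49/20) ≤ (11/30)²·(49/20) = 5929/18000 < 2/5 = 3(1/2 − 11/30)` (`SlabAreaLawVariance.hasAreaLaw_of_varianceBound'`), DF
criterion = tree theorem — `HasAreaLaw d (fundamentalRep (Fin 3)) (β_W/3)`.  `d = 4`: `β_W ≤ 11/20` (the booked row); `d = 3`: `33/40`;
`d = 5`: `33/80`.  Printed CNS25 Thm. 1.6: `β_W < 9/(8(d−1))`. [cite: CaoNissimSheffield2025dynamical, Theorems 1.6 and 2.3]
[cite: arXiv220412737, Lemma 4.1 with (4.4)-(4.6)] -/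
theorem su3_hasAreaLaw_of_varianceBound_dim {d : ℕ} (hd : 2 ≤ d) (hv : OneLinkVarianceBound 3 (11 / 30) (49 / 20))
    {βW : ℝ} (hβ : 0 ≤ βW) (hle : ((d : ℝ) - 1) * βW ≤ 33 / 20) :
    HasAreaLaw d (fundamentalRep (Fin 3)) (βW / 3) := by
  have hd1 : (0 : ℝ) ≤ (d : ℝ) - 1 := by
    have : (2 : ℝ) ≤ d := by exact_mod_cast hd
    linarith
  have h3 : ((3 : ℕ) : ℝ) * (βW / 9) = βW / 3 := by push_cast; ring
  rw [← h3]
  refine hasAreaLaw_of_varianceBound' (durhuusFrohlich_areaLaw_of_slabClustering_holds (d := d) (N := 3)) hd (by norm_num)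
    (β := βW / 9) (R := 11 / 30) (v := 49 / 20) (by positivity) (by norm_num) ?_ (by norm_num) hv ?_
  · -- radius: (βW/9)·2(d−1) ≤ 11/30
    nlinarith
  · -- door: (2(d−1)βW/9)²·(49/20) < 3·(1/2 − 11/30)
    have h0 : 0 ≤ 2 * ((d : ℝ) - 1) * (βW / 9) := by positivity
    have h1 : 2 * ((d : ℝ) - 1) * (βW / 9) ≤ 11 / 30 := by nlinarith
    have hsq : (2 * ((d : ℝ) - 1) * (βW / 9)) ^ 2 ≤ (11 / 30) ^ 2 := pow_le_pow_left₀ h0 h1 2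
    push_cast
    exact lt_of_le_of_lt (mul_le_mul_of_nonneg_right hsq (by norm_num)) (by norm_num)

/-- **`SU(3)`, `d = 3`: Wilson AREA LAW for every `0 ≤ β_W ≤ 33/40` — CONDITIONAL** on the displayed (certified outside the kernel)
`OneLinkVarianceBound 3 (11/30) (49/20)`; printed CNS: `β_W < 9/16`. [cite: CaoNissimSheffield2025dynamical, Theorems 1.6 and 2.3] -/
theorem su3_hasAreaLaw_d3_le_of_varianceBound (hv : OneLinkVarianceBound 3 (11 / 30) (49 / 20)) {βW : ℝ} (hβ : 0 ≤ βW)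
    (hle : βW ≤ 33 / 40) : HasAreaLaw 3 (fundamentalRep (Fin 3)) (βW / 3) :=
  su3_hasAreaLaw_of_varianceBound_dim (by norm_num) hv hβ (by push_cast; linarith)

/-! ## 3. Numbers -/

/-- Numbers: the `SU(2)` thresholds `2/(d−1)` against the printed `1/(2(d−1))` and the `SU(3)` caps `33/(20(d−1))` against the printed
`9/(8(d−1))` at `d = 3, 4, 5`; the slab radius identities; the door value `5929/18000 < 2/5`.  ERRATUM to the docstring of
`SlabAreaLawVariance.slabVarianceDoor_numbers` (same seat): with the Haar floor `v ≥ 3/2` the variance-only slab door `R²·v < 3(1/2 − R)` forces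
`R² < 1 − 2R`, i.e. `R < √2 − 1 = 0.4142…` (`β_W < 0.6213…`) — not `(√41 − 3)/8` as printed there; the kernel inequalities of that lemma
(door shut at `R = 17/40` with `v = 3/2`) are correct as stated, and `R = 21/50 = 0.42` is shut too (last conjunct below). [folklore] -/
theorem slabDimensions_numbers :
    (2 : ℝ) / (3 - 1) = 1 ∧ (2 : ℝ) / (4 - 1) = 2 / 3 ∧ (2 : ℝ) / (5 - 1) = 1 / 2 ∧
      (1 : ℝ) / (2 * (3 - 1)) = 1 / 4 ∧ (1 : ℝ) / (2 * (4 - 1)) = 1 / 6 ∧ (1 : ℝ) / (2 * (5 - 1)) = 1 / 8 ∧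
      (33 : ℝ) / (20 * (3 - 1)) = 33 / 40 ∧ (33 : ℝ) / (20 * (4 - 1)) = 11 / 20 ∧ (33 : ℝ) / (20 * (5 - 1)) = 33 / 80 ∧
      (9 : ℝ) / (8 * (3 - 1)) = 9 / 16 ∧ (9 : ℝ) / (8 * (4 - 1)) = 3 / 8 ∧ (9 : ℝ) / (8 * (5 - 1)) = 9 / 32 ∧
      (2 : ℝ) * (4 - 1) * ((2 / 3) / 4) = 1 ∧ (2 : ℝ) * (4 - 1) * ((11 / 20) / 9) = 11 / 30 ∧
      (11 / 30 : ℝ) ^ 2 * (49 / 20) = 5929 / 18000 ∧ (5929 : ℝ) / 18000 < 3 * (1 / 2 - 11 / 30) ∧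
      ¬ (21 / 50 : ℝ) ^ 2 * (3 / 2) < 3 * (1 / 2 - 21 / 50) := by
  norm_num

end Summit.Ventures.YMGap.SlabAreaLawDimensions
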